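import Summits.QuantumFields.YangMills.Theorems.FluctuationComparisonRegPrIntLS2BetaInterBlockCentral
import Summits.QuantumFields.YangMills.Theorems.UnitScaleTiltProp7AxialGaugeBlock
import Summits.QuantumFields.YangMills.Theorems.BalabanUVNodesN18CombStepAxialGauge
import Literature.MathematicalPhysics.QuantumFieldTheory.Balaban1983to89.B11GaugeGlue
import HarnessLib

/-!
# GAP♯∘'s KINEMATIC LETTER INTER₀∘, PART B — THE LOOP-FREE FACE TRANSFER AND THE GEOMETRY OF THE CROSSING SITES
# (crux `FluctuationComparisonRegPrIntL`, stmt-QuantumFields-20520; registry v11.4 `Cruxes/FluctuationComparisonRegPrIntL/Lines/semiclassical_s2beta.lean` 3732b7df FROZEN, untouched)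

Cell `ym3-torus` (YM ladder rung R3 = continuum `SU(2)` Yang–Mills on the three-torus — a RUNG: NOT d = 4, NOT infinite volume, NOT a mass gap, NOT Clay).
Seat `ym3-torus-px8` (gen 18; pen INTER₀∘, ★★OWNER WORD №205 ∕ LEAD WORD №14); `--kind proof --supports stmt-QuantumFields-20520 --as helper`, count-neutral,
DEFINITION-FREE (0 `def`, 0 `instance`, 0 `notation`, 0 `sorry`, default heartbeats).  Plan: HOME `ym3-torus-px8/g18/locate/LOCATE-INTER0-GEOMETRY-px8g18.md` §2 (d′).

WHAT.  Part A (✓`…S2BetaInterBlockCentral`) bounds the CENTRAL crossing link of a face.  This file moves that bound ALONG THE FACE, one fine step at a time,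
WITHOUT double-block loops: for a site `z` and two directions `κ ≠ μ` with `z + e_κ` in the block of `z`, the two commutator defects
`P_U = (U⟨z,κ⟩U⟨z+e_κ,μ⟩)·(U⟨z,μ⟩U⟨z+e_μ,κ⟩)⁻¹` (plaquette variables in either orientation, ✓`LatticeWordStokes.dist1_swapDefect_le`) express
`U⟨z+e_κ, μ⟩` through `U⟨z, μ⟩` and the two SIDE bonds `⟨z, κ⟩ ⊂ B(y)`, `⟨z+e_μ, κ⟩ ⊂ B(y′)`, which are INTERIOR bonds of their blocks and hence
`ι = d(L−1)·2α₀`-close in the relative comb-axial gauge (✓`Prop7AxialGaugeBlock.dist1_mul_inv_le_interior`):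
* §1 `blockOf` coordinate bookkeeping (the side bond beyond the face is interior to the next block);
* §2 two pure group-algebra rows ([Balaban1985Averaging] (19)–(20) unitary invariance; `dist1_inv_mul_eq` is ✓`B11GaugeGlue`'s);
* §3 ★★ `dist1_cross_shift_le` ∕ `dist1_cross_le_shift` — THE FACE TRANSFER: `|D(z + e_κ) − D(z)| ≤ 2ι + δ_W + δ_Y`, `D(z) = dist1(W⟨z,μ⟩·Y⟨z,μ⟩⁻¹)`;
* §4 the crossing sites of a face in relative coordinates: `blockOf (z + e_μ) ≠ blockOf z` with `blockOf z = y` iff `z = emb y + v`, `|v|_∞ ≤ h`, `v_μ = h`.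

HONEST: kinematic bookkeeping; INTER₀∘ (the sweep over the face), CLOSE-PAIR∘, GAP♯∘, crux 20520 are NOT proved here; no summit statement is proved by a helper;
finite-volume ∕ conditional; rung R3 = SU(2) YM₃ on T³ — NOT d = 4, NOT infinite volume, NOT a mass gap, NOT Clay; the Yang–Mills mass gap is NOT proved.
Sorry-free, axioms standard.

References: T. Bałaban, CMP **99** (1985) 75–102 [Balaban1985RegularSpaces] (Lemma 1 (1.24)–(1.26) pp.79–80); CMP **98** (1985) 17–51 [Balaban1985Averaging] ((9) p.19,
(19)–(20) p.21, pp.24–25); CMP **109** (1987) 249–301 [Balaban1987RG1] ((0.1)–(0.3) pp.251–252).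
-/

set_option autoImplicit false

noncomputable section

namespace Summit.QuantumFields.YangMills.Theorems.FluctuationComparisonRegPrIntLS2BetaInterBlockFace

open Literature.MathematicalPhysics.QuantumFieldTheory.Balaban1983to89
open T4Continuum BlockAveraging LatticeWordStokes
open B7Prop1Explicit (Letter e e_apply l1)
open B10Eq27TorusAxialLog (axialT rel transl transl_apply transl_add transl_add_e transl_zero rel_transl_of_mem transl_rel)
open B5Eq118OneStroke (iterBlockOf)
open B15DeterminingSets (embIter)
open Summit.QuantumFields.YangMills.Theorems.Prop7AxialGaugeBlock (dist1_mul_inv_le_interior)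
open Summit.QuantumFields.YangMills.Theorems.FluctuationComparisonRegPrIntLS2BetaInterBlockCentral (rel_emb_transl blockOf_transl_emb)
open YMDAG.N18.TransportOfRecord (rel_emb_blockSite)
open Literature.MathematicalPhysics.QuantumFieldTheory.Balaban1983to89.BlockAveragingSectionQsstar (eq_blockSite_blockEquiv)
open Literature.MathematicalPhysics.QuantumFieldTheory.Balaban1983to89.B11GaugeGlue (dist1_inv_mul_eq)

variable {P : Params} {j : ℕ}

/-! ## §1 `blockOf` coordinate bookkeeping -/

section Blocks

/-- The `ν`-label of `blockOf x` depends only on the `ν`-coordinate of `x`. [cite: Balaban1987RG1, (0.3) p.252] -/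
theorem blockOf_apply_congr {x x' : Site P j} {ν : Fin P.d} (h : x ν = x' ν) : blockOf x ν = blockOf x' ν := by
  simp only [blockOf, h]

/-- A step in direction `μ` does not change the other labels of the block. [cite: Balaban1987RG1, (0.3) p.252] -/
theorem blockOf_shift_apply_of_ne (x : Site P j) {μ ν : Fin P.d} (h : ν ≠ μ) : blockOf (x.shift μ) ν = blockOf x ν :=
  blockOf_apply_congr (by rw [Site.shift_apply, if_neg h])

/-- **The side bond beyond the face is interior to the next block**: if `z + e_κ` lies in the block of `z` and `κ ≠ μ`, then `(z + e_μ) + e_κ` lies in the block of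
`z + e_μ`. [cite: Balaban1987RG1, (0.3) p.252] -/
theorem blockOf_shift_shift_eq (z : Site P j) {μ κ : Fin P.d} (hκμ : κ ≠ μ) (hin : blockOf (z.shift κ) = blockOf z) :
    blockOf ((z.shift μ).shift κ) = blockOf (z.shift μ) := by
  funext ν
  by_cases hν : ν = κ
  · subst hν
    have h1 : blockOf ((z.shift μ).shift ν) ν = blockOf (z.shift ν) ν :=
      blockOf_apply_congr (by rw [Site.shift_apply, Site.shift_apply, Site.shift_apply, if_pos rfl, if_pos rfl, if_neg hκμ])
    rw [h1, show blockOf (z.shift ν) ν = blockOf z ν by rw [hin], blockOf_shift_apply_of_ne z hκμ]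
  · exact blockOf_shift_apply_of_ne _ hν

end Blocks

/-! ## §2 Two rows of group algebra -/

section Algebra

variable {G : Type*} [GaugeGroup G]

/-- **FORWARD ROW.**  If `P = a·x·(c·b)⁻¹` and `P′ = a′·x′·(c′·b′)⁻¹` (so `x = a⁻¹·P·c·b`), then
`dist1(x·x′⁻¹) ≤ dist1(c·c′⁻¹) + dist1(a·a′⁻¹) + dist1(b·b′⁻¹) + dist1 P + dist1 P′`. [cite: Balaban1985Averaging, (19)-(20) p.21] -/
theorem dist1_transfer_fwd (a a' b b' c c' x x' : G) :
    dist1 (x * x'⁻¹) ≤ dist1 (c * c'⁻¹) + dist1 (a * a'⁻¹) + dist1 (b * b'⁻¹) +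
      dist1 (a * x * (c * b)⁻¹) + dist1 (a' * x' * (c' * b')⁻¹) := by
  set Pw := a * x * (c * b)⁻¹ with hPw
  set Py := a' * x' * (c' * b')⁻¹ with hPy
  have hM : x * x'⁻¹ = a⁻¹ * (Pw * (c * (b * b'⁻¹) * c⁻¹) * (c * c'⁻¹) * Py⁻¹) * a⁻¹⁻¹ * (a⁻¹ * a') := by
    rw [hPw, hPy]; group
  rw [hM]
  calc dist1 (a⁻¹ * (Pw * (c * (b * b'⁻¹) * c⁻¹) * (c * c'⁻¹) * Py⁻¹) * a⁻¹⁻¹ * (a⁻¹ * a'))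
      ≤ dist1 (a⁻¹ * (Pw * (c * (b * b'⁻¹) * c⁻¹) * (c * c'⁻¹) * Py⁻¹) * a⁻¹⁻¹) + dist1 (a⁻¹ * a') := GaugeGroup.dist1_mul_le _ _
    _ = dist1 (Pw * (c * (b * b'⁻¹) * c⁻¹) * (c * c'⁻¹) * Py⁻¹) + dist1 (a * a'⁻¹) := by rw [GaugeGroup.dist1_conj, dist1_inv_mul_eq]
    _ ≤ (dist1 Pw + dist1 (b * b'⁻¹) + dist1 (c * c'⁻¹) + dist1 Py) + dist1 (a * a'⁻¹) := by
        refine add_le_add ?_ le_rfl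
        calc dist1 (Pw * (c * (b * b'⁻¹) * c⁻¹) * (c * c'⁻¹) * Py⁻¹)
            ≤ dist1 (Pw * (c * (b * b'⁻¹) * c⁻¹) * (c * c'⁻¹)) + dist1 Py⁻¹ := GaugeGroup.dist1_mul_le _ _
          _ ≤ (dist1 (Pw * (c * (b * b'⁻¹) * c⁻¹)) + dist1 (c * c'⁻¹)) + dist1 Py⁻¹ := add_le_add (GaugeGroup.dist1_mul_le _ _) le_rfl
          _ ≤ ((dist1 Pw + dist1 (c * (b * b'⁻¹) * c⁻¹)) + dist1 (c * c'⁻¹)) + dist1 Py⁻¹ :=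
              add_le_add (add_le_add (GaugeGroup.dist1_mul_le _ _) le_rfl) le_rfl
          _ = dist1 Pw + dist1 (b * b'⁻¹) + dist1 (c * c'⁻¹) + dist1 Py := by rw [GaugeGroup.dist1_conj, GaugeGroup.dist1_inv]
    _ = _ := by ring

/-- **BACKWARD ROW.**  With the same letters (`c = P⁻¹·a·x·b⁻¹`):
`dist1(c·c′⁻¹) ≤ dist1(x·x′⁻¹) + dist1(a·a′⁻¹) + dist1(b·b′⁻¹) + dist1 P + dist1 P′`. [cite: Balaban1985Averaging, (19)-(20) p.21] -/
theorem dist1_transfer_bwd (a a' b b' c c' x x' : G) :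
    dist1 (c * c'⁻¹) ≤ dist1 (x * x'⁻¹) + dist1 (a * a'⁻¹) + dist1 (b * b'⁻¹) +
      dist1 (a * x * (c * b)⁻¹) + dist1 (a' * x' * (c' * b')⁻¹) := by
  set Pw := a * x * (c * b)⁻¹ with hPw
  set Py := a' * x' * (c' * b')⁻¹ with hPy
  have hM : c * c'⁻¹ = Pw⁻¹ * (a * ((x * (b⁻¹ * b') * x⁻¹) * (x * x'⁻¹)) * a⁻¹ * (a * a'⁻¹)) * Py := by
    rw [hPw, hPy]; group
  rw [hM]
  calc dist1 (Pw⁻¹ * (a * ((x * (b⁻¹ * b') * x⁻¹) * (x * x'⁻¹)) * a⁻¹ * (a * a'⁻¹)) * Py)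
      ≤ dist1 (Pw⁻¹ * (a * ((x * (b⁻¹ * b') * x⁻¹) * (x * x'⁻¹)) * a⁻¹ * (a * a'⁻¹))) + dist1 Py := GaugeGroup.dist1_mul_le _ _
    _ ≤ (dist1 Pw⁻¹ + dist1 (a * ((x * (b⁻¹ * b') * x⁻¹) * (x * x'⁻¹)) * a⁻¹ * (a * a'⁻¹))) + dist1 Py :=
        add_le_add (GaugeGroup.dist1_mul_le _ _) le_rfl
    _ ≤ (dist1 Pw⁻¹ + (dist1 (a * ((x * (b⁻¹ * b') * x⁻¹) * (x * x'⁻¹)) * a⁻¹) + dist1 (a * a'⁻¹))) + dist1 Py :=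
        add_le_add (add_le_add le_rfl (GaugeGroup.dist1_mul_le _ _)) le_rfl
    _ = (dist1 Pw + (dist1 ((x * (b⁻¹ * b') * x⁻¹) * (x * x'⁻¹)) + dist1 (a * a'⁻¹))) + dist1 Py := by
        rw [GaugeGroup.dist1_inv, GaugeGroup.dist1_conj]
    _ ≤ (dist1 Pw + ((dist1 (x * (b⁻¹ * b') * x⁻¹) + dist1 (x * x'⁻¹)) + dist1 (a * a'⁻¹))) + dist1 Py :=
        add_le_add (add_le_add le_rfl (add_le_add (GaugeGroup.dist1_mul_le _ _) le_rfl)) le_rfl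
    _ = (dist1 Pw + ((dist1 (b * b'⁻¹) + dist1 (x * x'⁻¹)) + dist1 (a * a'⁻¹))) + dist1 Py := by
        rw [GaugeGroup.dist1_conj, dist1_inv_mul_eq]
    _ = _ := by ring

end Algebra

/-! ## §3 The face transfer -/

section Transfer

variable {G : Type*} [GaugeGroup G]

/-- ★★ **THE FACE TRANSFER, FORWARD** (level `0`, one block level).  `W`, `Y` with plaquette variables within `δ_W, δ_Y ≥ 0` of `1`, `W` comb-axial relative to `Y`
(same comb transporters from the centre of every site's block), `κ ≠ μ`, and `z + e_κ` in the block of `z`: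
`dist1(W⟨z+e_κ,μ⟩·Y⟨z+e_κ,μ⟩⁻¹) ≤ dist1(W⟨z,μ⟩·Y⟨z,μ⟩⁻¹) + (2·d·(L−1) + 1)·(δ_W + δ_Y)` — the two side bonds are interior (`Prop7AxialGaugeBlock`), the two
commutator defects are plaquettes (`LatticeWordStokes`). [cite: Balaban1985RegularSpaces, Lemma 1 (1.25) p.79; Balaban1985Averaging, (19)-(20) p.21, pp.24-25] -/
theorem dist1_cross_shift_le (hk : 1 ≤ P.m + P.K) (W Y : GaugeField P 0 G) {δW δY : ℝ} (hδW : 0 ≤ δW) (hδY : 0 ≤ δY)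
    (hW : PlaqSmall δW W) (hY : PlaqSmall δY Y)
    (hax : ∀ x : Site P 0, axialT W (embIter 1 (iterBlockOf 1 x)) x = axialT Y (embIter 1 (iterBlockOf 1 x)) x)
    (z : Site P 0) {μ κ : Fin P.d} (hκμ : κ ≠ μ) (hin : iterBlockOf 1 (z.shift κ) = iterBlockOf 1 z) :
    dist1 (W ⟨z.shift κ, μ⟩ * (Y ⟨z.shift κ, μ⟩)⁻¹) ≤
      dist1 (W ⟨z, μ⟩ * (Y ⟨z, μ⟩)⁻¹) + (2 * ((P.d : ℝ) * ((P.L : ℝ) - 1)) + 1) * (δW + δY) := by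
  have hin' : iterBlockOf 1 ((z.shift μ).shift κ) = iterBlockOf 1 (z.shift μ) := blockOf_shift_shift_eq z hκμ hin
  have h1 := dist1_mul_inv_le_interior (k := 1) hk W Y hδW hδY hW hY hax z κ hin
  have h2 := dist1_mul_inv_le_interior (k := 1) hk W Y hδW hδY hW hY hax (z.shift μ) κ hin'
  have hPW := dist1_swapDefect_le W hδW hW z (κ, true) (μ, true)
  have hPY := dist1_swapDefect_le Y hδY hY z (κ, true) (μ, true)
  rw [holAt_walk_tt, holAt_walk_tt] at hPW hPY
  have halg := dist1_transfer_fwd (W ⟨z, κ⟩) (Y ⟨z, κ⟩) (W ⟨z.shift μ, κ⟩) (Y ⟨z.shift μ, κ⟩) (W ⟨z, μ⟩) (Y ⟨z, μ⟩)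
    (W ⟨z.shift κ, μ⟩) (Y ⟨z.shift κ, μ⟩)
  rw [pow_one] at h1 h2
  nlinarith [GaugeGroup.dist1_nonneg (W ⟨z, κ⟩ * (Y ⟨z, κ⟩)⁻¹)]

/-- ★★ **THE FACE TRANSFER, BACKWARD**: the same bound with `z` and `z + e_κ` exchanged. [cite: Balaban1985RegularSpaces, Lemma 1 (1.25) p.79; Balaban1985Averaging, (19)-(20) p.21] -/
theorem dist1_cross_le_shift (hk : 1 ≤ P.m + P.K) (W Y : GaugeField P 0 G) {δW δY : ℝ} (hδW : 0 ≤ δW) (hδY : 0 ≤ δY)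
    (hW : PlaqSmall δW W) (hY : PlaqSmall δY Y)
    (hax : ∀ x : Site P 0, axialT W (embIter 1 (iterBlockOf 1 x)) x = axialT Y (embIter 1 (iterBlockOf 1 x)) x)
    (z : Site P 0) {μ κ : Fin P.d} (hκμ : κ ≠ μ) (hin : iterBlockOf 1 (z.shift κ) = iterBlockOf 1 z) :
    dist1 (W ⟨z, μ⟩ * (Y ⟨z, μ⟩)⁻¹) ≤
      dist1 (W ⟨z.shift κ, μ⟩ * (Y ⟨z.shift κ, μ⟩)⁻¹) + (2 * ((P.d : ℝ) * ((P.L : ℝ) - 1)) + 1) * (δW + δY) := by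
  have hin' : iterBlockOf 1 ((z.shift μ).shift κ) = iterBlockOf 1 (z.shift μ) := blockOf_shift_shift_eq z hκμ hin
  have h1 := dist1_mul_inv_le_interior (k := 1) hk W Y hδW hδY hW hY hax z κ hin
  have h2 := dist1_mul_inv_le_interior (k := 1) hk W Y hδW hδY hW hY hax (z.shift μ) κ hin'
  have hPW := dist1_swapDefect_le W hδW hW z (κ, true) (μ, true)
  have hPY := dist1_swapDefect_le Y hδY hY z (κ, true) (μ, true)
  rw [holAt_walk_tt, holAt_walk_tt] at hPW hPY
  have halg := dist1_transfer_bwd (W ⟨z, κ⟩) (Y ⟨z, κ⟩) (W ⟨z.shift μ, κ⟩) (Y ⟨z.shift μ, κ⟩) (W ⟨z, μ⟩) (Y ⟨z, μ⟩)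
    (W ⟨z.shift κ, μ⟩) (Y ⟨z.shift κ, μ⟩)
  rw [pow_one] at h1 h2
  nlinarith [GaugeGroup.dist1_nonneg (W ⟨z, κ⟩ * (Y ⟨z, κ⟩)⁻¹)]

end Transfer

/-! ## §4 The crossing sites of a face in relative coordinates -/

section Crossing

/-- A site of `B(y)` has relative position `|·|_∞ ≤ h = (L−1)∕2` from the centre. [cite: Balaban1987RG1, (0.3) p.252] -/
theorem natAbs_rel_emb_le_of_blockOf (hj : j + 1 ≤ P.m + P.K) {y : Site P (j + 1)} {z : Site P j} (hz : blockOf z = y) (ν : Fin P.d) :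
    (rel (emb y) z ν).natAbs ≤ (P.L - 1) / 2 := by
  obtain ⟨r, hr⟩ : ∃ r : Fin P.d → Fin P.L, z = Site.blockSite (blockOf z) r := ⟨_, eq_blockSite_blockEquiv hj z⟩
  rw [hz] at hr
  rw [hr, rel_emb_blockSite hj]
  have hb := off_bounds r ν
  rcases Int.natAbs_eq (off r ν) with hh | hh <;> omega

/-- **A crossing site sits ON the face**: if `z ∈ B(y)` and `z + e_μ ∉ B(y)`, then `(z − emb y)_μ = h`. [cite: Balaban1987RG1, (0.3) p.252] -/
theorem rel_emb_eq_half_of_cross (hj : j + 1 ≤ P.m + P.K) {y : Site P (j + 1)} {z : Site P j} (hz : blockOf z = y)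
    {μ : Fin P.d} (hcross : blockOf (z.shift μ) ≠ blockOf z) :
    rel (emb y) z μ = (((P.L - 1) / 2 : ℕ) : ℤ) := by
  by_contra hne
  have hle : ∀ ν, (rel (emb y) z ν).natAbs ≤ (P.L - 1) / 2 := natAbs_rel_emb_le_of_blockOf hj hz
  have hlt : rel (emb y) z μ + 1 ≤ (((P.L - 1) / 2 : ℕ) : ℤ) := by
    have h1 := hle μ
    rcases Int.natAbs_eq (rel (emb y) z μ) with hh | hh <;> omega
  apply hcross
  rw [hz]
  have hzv : z.shift μ = transl (emb y) (rel (emb y) z + e μ) := by rw [transl_add_e, transl_rel]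
  rw [hzv]
  refine blockOf_transl_emb hj y fun ν => ?_
  rw [Pi.add_apply, e_apply]
  by_cases hν : ν = μ
  · subst hν
    rw [if_pos rfl]
    have h1 := hle ν
    rcases Int.natAbs_eq (rel (emb y) z ν) with hh | hh <;> omega
  · rw [if_neg hν, add_zero]; exact hle ν

/-- **Conversely, every site `emb y + v` with `|v|_∞ ≤ h` and `v_μ = h` is a crossing site over `y`**: it lies in `B(y)` and `emb y + v + e_μ` does not.
[cite: Balaban1987RG1, (0.3) p.252] -/
theorem cross_of_rel (hj : j + 1 ≤ P.m + P.K) (y : Site P (j + 1)) {μ : Fin P.d} {v : B7Prop1Explicit.Site P.d}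
    (hv : ∀ ν, (v ν).natAbs ≤ (P.L - 1) / 2) (hvμ : v μ = (((P.L - 1) / 2 : ℕ) : ℤ)) :
    blockOf (transl (emb y) v) = y ∧ blockOf ((transl (emb y) v).shift μ) ≠ blockOf (transl (emb y) v) := by
  have hy : blockOf (transl (emb y) v) = y := blockOf_transl_emb hj y hv
  refine ⟨hy, fun heq => ?_⟩
  rw [hy, ← transl_add_e] at heq
  -- `emb y + (v + e_μ)` would lie in `B(y)`, so `|(v + e_μ)_μ| ≤ h`; but `(v + e_μ)_μ = h + 1`
  have h1 := natAbs_rel_emb_le_of_blockOf hj heq μ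
  rw [rel_emb_transl hj y (fun ν => ?_)] at h1
  · rw [Pi.add_apply, e_apply, if_pos rfl, hvμ] at h1
    omega
  · rw [Pi.add_apply, e_apply]
    have h2 := hv ν
    split_ifs
    · rcases Int.natAbs_eq (v ν) with hh | hh <;> omega
    · rw [add_zero]; exact h2.trans (Nat.le_succ _)

/-- A crossing site in relative coordinates: `z = emb y + v` with `|v|_∞ ≤ h`, `v_μ = h` (`v = z − emb y`). [cite: Balaban1987RG1, (0.3) p.252] -/
theorem exists_rel_of_cross (hj : j + 1 ≤ P.m + P.K) {z : Site P j} {μ : Fin P.d} (hcross : blockOf (z.shift μ) ≠ blockOf z) :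
    ∃ v : B7Prop1Explicit.Site P.d, (∀ ν, (v ν).natAbs ≤ (P.L - 1) / 2) ∧ v μ = (((P.L - 1) / 2 : ℕ) : ℤ) ∧
      z = transl (emb (blockOf z)) v :=
  ⟨rel (emb (blockOf z)) z, natAbs_rel_emb_le_of_blockOf hj rfl, rel_emb_eq_half_of_cross hj rfl hcross, (transl_rel _ _).symm⟩

end Crossing

end Summit.QuantumFields.YangMills.Theorems.FluctuationComparisonRegPrIntLS2BetaInterBlockFace

end
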